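import Mathlib
import Literature.AlgebraicGeometry.Resolution.FiniteBirationalNormal
import Literature.AlgebraicGeometry.Resolution.QuasiProjectiveResolution
import Literature.AlgebraicGeometry.Resolution.ResolutionOfIsoLocus
import Literature.AlgebraicGeometry.Resolution.RegularLocalRingsNormal
import Literature.AlgebraicGeometry.Resolution.PrincipalizationToResolution
import Literature.AlgebraicGeometry.Resolution.NormalizationSection
import Literature.AlgebraicGeometry.Resolution.ResolutionGlue

/-!
# `PicoverToRadicialBottom` — stub S0: resolutions lift along finite birational morphisms

Crux `stmt-ResolutionOfSingularities-0556`, line `theta-finite-cofinite-roots`, stub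
`stub_finiteBirationalLift`.

Let `φ : T → X''` be finite and birational between integral schemes and `π : Z → X''` a
resolution (`π` proper birational, `Z` regular). Then `Z` is integral, locally Noetherian and
NORMAL (regular local rings are integrally closed, Matsumura 19.4), so `π` factors through `φ`:
over the common dense open `U₀ ⊆ X''` where both `φ` and `π` are isomorphisms, the open
`V = π⁻¹U₀ ⊆ Z` has the section `s = (V ↪ Z, V ≅ U₀ ≅ φ⁻¹U₀ ↪ T)` into the fibre product
`P = Z ×_{X''} T`, whose first projection `p₁ : P → Z` is finite; by the universal property of
Mathlib's relative normalization (`Scheme.Hom.normalizationDesc`) applied to `V ↪ P → Z`, the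
normalization `N` of `Z` in `V` maps to `P` over `Z`, and `N → Z` is an isomorphism because it has
a section over a non-empty affine open and `Z` is normal (`isIso_fromNormalization_of_section`).
The composite `ρ : Z ≅ N → P → T` satisfies `ρ ≫ φ = π`, hence is proper (`φ` is separated) and
an isomorphism over the dense open `φ⁻¹U₀` of `T`; a proper morphism from a regular locally
Noetherian scheme which is an isomorphism over a dense open yields a resolution
(`hasResolution_of_isIso_morphismRestrict`).
-/

noncomputable section

-- single-problem summit: the doubled namespace component `ResolutionOfSingularities` is forced
set_option linter.dupNamespace false

open CategoryTheory CategoryTheory.Limits AlgebraicGeometry TopologicalSpace Opposite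
open Literature.AlgebraicGeometry.Resolution

namespace Summit.ResolutionOfSingularities.ResolutionOfSingularities.Theorems

/-- **A morphism from a normal integral scheme lifts along a finite morphism which is an
isomorphism over an open met by its image**: if `π : Z → X` with `Z` integral, locally
Noetherian and normal (all local rings integrally closed), `φ : T → X` is finite, and `U₀ ⊆ X`
is an open with `π⁻¹U₀ ≠ ∅` over which `φ` is an isomorphism, then there is `ρ : Z → T` with
`ρ ≫ φ = π` — the relative normalization of `Z` in `π⁻¹U₀` is `Z` itself (it has a section over
a non-empty affine open and `Z` is normal), and it maps to `Z ×_X T` by the universal property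
of the relative normalization applied to the section `π⁻¹U₀ → Z ×_X T` of the finite projection
`Z ×_X T → Z` (Stacks 035I, 0AB1). [folklore] -/
theorem exists_lift_of_isFinite_of_normal {Z T X : Scheme.{0}} [IsIntegral Z]
    [IsLocallyNoetherian Z] (hnorm : ∀ z : Z, IsIntegrallyClosed (Z.presheaf.stalk z))
    (π : Z ⟶ X) (φ : T ⟶ X) [IsFinite φ] (U₀ : X.Opens) [IsIso (φ ∣_ U₀)]
    (hne : ((π ⁻¹ᵁ U₀ : Z.Opens) : Set Z).Nonempty) :
    ∃ ρ : Z ⟶ T, ρ ≫ φ = π := by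
  -- the section of `P = Z ×_X T → Z` over `V = π⁻¹ U₀`
  set V : Z.Opens := π ⁻¹ᵁ U₀
  let t : (V : Scheme.{0}) ⟶ T := (π ∣_ U₀) ≫ inv (φ ∣_ U₀) ≫ (φ ⁻¹ᵁ U₀).ι
  have ht : V.ι ≫ π = t ≫ φ := by
    simp only [t, Category.assoc]
    rw [← morphismRestrict_ι φ U₀, IsIso.inv_hom_id_assoc, morphismRestrict_ι]
  let s : (V : Scheme.{0}) ⟶ pullback π φ := pullback.lift V.ι t ht
  have hs : V.ι = s ≫ pullback.fst π φ := (pullback.lift_fst _ _ _).symm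
  -- `V` is a non-empty open of the integral `Z`
  obtain ⟨z, hz⟩ := hne
  haveI : Nonempty (V : Scheme.{0}) := ⟨⟨z, hz⟩⟩
  haveI : IsIntegral (V : Scheme.{0}) := isIntegral_of_isOpenImmersion V.ι
  -- a non-empty affine open `W ⊆ V` and the section `W → V` of `V ↪ Z` over it
  obtain ⟨_, ⟨W, hWaff, rfl⟩, hzW, hWV⟩ :=
    Z.isBasis_affineOpens.exists_subset_of_mem_open hz V.isOpen
  haveI : Nonempty W := ⟨⟨z, hzW⟩⟩
  have hσ : Z.homOfLE hWV ≫ V.ι = Scheme.Opens.ι W := Scheme.homOfLE_ι Z hWV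
  -- the normalization of `Z` in `V` is `Z`
  haveI : IsIso V.ι.fromNormalization :=
    isIso_fromNormalization_of_section V.ι hnorm hWaff (Z.homOfLE hWV) hσ
  -- the universal property of the relative normalization
  let d : V.ι.normalization ⟶ pullback π φ := V.ι.normalizationDesc s (pullback.fst π φ) hs
  have hd : d ≫ pullback.fst π φ = V.ι.fromNormalization := V.ι.normalizationDesc_comp _ _ hs
  refine ⟨inv V.ι.fromNormalization ≫ d ≫ pullback.snd π φ, ?_⟩
  rw [Category.assoc, Category.assoc, ← pullback.condition, ← Category.assoc d, hd,
    IsIso.inv_hom_id_assoc]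

/-- **S0 (finite birational lift).** A resolution of `X''` lifts along a finite birational
`φ : T ⟶ X''` between integral schemes of finite type over a field. [folklore] -/
theorem stub_finiteBirationalLift : ∀ (k : Type) [Field k] (X'' T : Scheme.{0}) [IsIntegral X'']
    [IsIntegral T] (f'' : X'' ⟶ Spec (.of k)) [LocallyOfFiniteType f''] [QuasiCompact f'']
    (φ : T ⟶ X'') [IsFinite φ], IsBirational φ → Scheme.HasResolution X'' →
    Scheme.HasResolution T := by
  intro k _ X'' T _ _ f'' _ _ φ _ hφ hres
  obtain ⟨Z, π, hπ⟩ := hres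
  haveI := hπ.isProper
  have hreg := hπ.isRegular
  -- `Z` is integral, normal and locally Noetherian
  haveI : IsReduced Z := hreg.isReduced
  haveI : IrreducibleSpace Z := hπ.isBirational.irreducibleSpace
  haveI : IsIntegral Z := isIntegral_of_irreducibleSpace_of_isReduced Z
  have hnorm : ∀ z : Z, IsIntegrallyClosed (Z.presheaf.stalk z) := fun z =>
    haveI := hreg z
    isIntegrallyClosed_of_isRegularLocalRing _
  haveI : IsLocallyNoetherian Z := LocallyOfFiniteType.isLocallyNoetherian (π ≫ f'')
  -- a common dense open `U₀ ⊆ X''` over which `φ` and `π` are isomorphisms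
  obtain ⟨U₁, hU₁, -, hiso₁⟩ := hφ
  obtain ⟨U₂, hU₂, -, hiso₂⟩ := hπ.isBirational
  haveI hisoφ : IsIso (φ ∣_ (U₁ ⊓ U₂)) := isIso_morphismRestrict_of_le φ hiso₁ inf_le_left
  haveI hisoπ : IsIso (π ∣_ (U₁ ⊓ U₂)) := isIso_morphismRestrict_of_le π hiso₂ inf_le_right
  obtain ⟨x, hx₂, hx₁⟩ := hU₁.inter_open_nonempty _ U₂.isOpen hU₂.nonempty
  have hx : x ∈ U₁ ⊓ U₂ := ⟨hx₁, hx₂⟩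
  -- the lift `ρ : Z → T`, `ρ ≫ φ = π`
  have hne : ((π ⁻¹ᵁ (U₁ ⊓ U₂) : Z.Opens) : Set Z).Nonempty := by
    obtain ⟨z, hz⟩ := (Scheme.homeoOfIso (asIso (π ∣_ (U₁ ⊓ U₂)))).symm ⟨x, hx⟩
    exact ⟨z, hz⟩
  obtain ⟨ρ, hρ⟩ := exists_lift_of_isFinite_of_normal hnorm π φ (U₁ ⊓ U₂) hne
  -- `ρ` is proper and an isomorphism over the dense open `φ⁻¹ U₀` of `T`
  haveI : IsProper ρ := by
    have : IsProper (ρ ≫ φ) := by rw [hρ]; infer_instance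
    exact IsProper.of_comp ρ φ
  have hisoρ : IsIso (ρ ∣_ φ ⁻¹ᵁ (U₁ ⊓ U₂)) := by
    have h1 : IsIso ((ρ ≫ φ) ∣_ (U₁ ⊓ U₂)) := by rw [hρ]; exact hisoπ
    rw [morphismRestrict_comp] at h1
    exact (isIso_comp_right_iff (ρ ∣_ φ ⁻¹ᵁ (U₁ ⊓ U₂)) (φ ∣_ (U₁ ⊓ U₂))).mp h1
  have hdense : Dense ((φ ⁻¹ᵁ (U₁ ⊓ U₂) : T.Opens) : Set T) := by
    obtain ⟨t, ht⟩ := (Scheme.homeoOfIso (asIso (φ ∣_ (U₁ ⊓ U₂)))).symm ⟨x, hx⟩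
    exact (φ ⁻¹ᵁ (U₁ ⊓ U₂)).2.dense ⟨t, ht⟩
  exact hasResolution_of_isIso_morphismRestrict ρ hreg (φ ⁻¹ᵁ (U₁ ⊓ U₂)) hdense hisoρ

end Summit.ResolutionOfSingularities.ResolutionOfSingularities.Theorems

end
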